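import Summits.Ventures.PercRepro.RankLevelSetDepCountGiantA2
import Summits.Ventures.PercRepro.RankLevelSetCorankFiveCounts

/-!
# PercRepro — THE `U`-COUNT WITH THE BIG CLASS EMPTY (p8, S3)

`proofs/SUBCLAIM-S3-p8.md` §3d. When `q + d ≤ f′ + 1` every rank-`≤ q` closure has at most `q + d ≤ f′ + 1` points
(nullity `≤ d`, `encard_le_eRk_add_of_encard_eq`), so `pairsBig M q f′ = ∅` and night-1's split count reduces to
its SMALL class: **`ncard_eRk_eq_ncard_le_le_small`** (in `ℚ`):
`#{B ⊆ E : r(B) = q, |B| ≤ d} ≤ C(n, q) + σ(f′ − q)·Σ_k s_k·C(n, q + 1 − k)`, `σ(m) = Σ_{j ≤ d−q−1} C(m, j)/(j + 1)`.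
At level `6` on the `e`-free core (`f′ = 21`) this is the corank range `d ≤ 16` — exactly the binding coranks of
the giant-flat count. Axioms: standard.
-/

open scoped Matroid

namespace PercRepro

namespace Matroid

open Set Finset

variable {α : Type} {M : _root_.Matroid α}

open scoped Classical in
/-- **No big pair when `q + d ≤ f′ + 1`**: the closure of a pair has rank `≤ q` and nullity `≤ d`. -/
theorem pairsBig_eq_empty [M.Finite] (q f' : ℕ) {d : ℕ} (hd : M.E.encard = M.eRank + d)
    (hsmall : q + d ≤ f' + 1) : pairsBig M q f' = ∅ := by
  unfold pairsBig
  rw [Finset.filter_eq_empty_iff]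
  intro p hp hbig
  apply hbig
  obtain ⟨hp1E, hp2E, -, hU, -⟩ := pairsF_data hp
  have hclE : M.closure (p.1 ∪ p.2) ⊆ M.E := M.closure_subset_ground _
  have hrk : M.eRk (M.closure (p.1 ∪ p.2)) ≤ q := by rw [M.eRk_closure_eq]; exact hU
  have h1 := encard_le_eRk_add_of_encard_eq (M := M) hclE hd
  have hfin : (M.closure (p.1 ∪ p.2)).Finite := M.ground_finite.subset hclE
  rw [← hfin.cast_ncard_eq] at h1
  have h2 : ((M.closure (p.1 ∪ p.2)).ncard : ℕ∞) ≤ (q : ℕ∞) + d := h1.trans (by gcongr)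
  have h3 : (M.closure (p.1 ∪ p.2)).ncard ≤ q + d := by exact_mod_cast h2
  omega

open scoped Classical in
/-- **The `U`-count with the big class empty** (`q + d ≤ f′ + 1`), in `ℚ`:
`#{B ⊆ E : r(B) = q, |B| ≤ d} ≤ C(n, q) + σ(f′ − q) · Σ_k s_k · C(n, q + 1 − k)`. -/
theorem ncard_eRk_eq_ncard_le_le_small (M : _root_.Matroid α) [M.Finite] (q f f' : ℕ)
    (hcirc : ∀ C, M.IsCircuit C → 3 ≤ C.encard)
    (hflat : ∀ X ⊆ M.E, M.eRk X ≤ q → X.ncard ≤ f)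
    {d : ℕ} (hd : M.E.encard = M.eRank + d) (hsmall : q + d ≤ f' + 1) :
    ({B : Set α | B ⊆ M.E ∧ M.eRk B = q ∧ B.ncard ≤ d}.ncard : ℚ) ≤
      (M.E.ncard.choose q : ℚ) +
        (∑ j ∈ Finset.range (d - (q + 1) + 1), ((f' - q).choose j : ℚ) / (j + 1)) *
          (∑ k ∈ Finset.Icc 3 (q + 1),
            ({C | M.IsCircuit C ∧ C.ncard = k}.ncard : ℚ) * (M.E.ncard.choose (q + 1 - k) : ℚ)) := by
  set Ef := groundF M with hEf
  have hE : (Ef : Set α) = M.E := coe_groundF M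
  have hEcard : Ef.card = M.E.ncard := card_groundF M
  set S := {B : Set α | B ⊆ M.E ∧ M.eRk B = q ∧ B.ncard ≤ d} with hS
  set S₁ := {B : Set α | B ⊆ (Ef : Set α) ∧ B.ncard = q} with hS₁
  set S₂ := {B : Set α | B ⊆ M.E ∧ M.eRk B = q ∧ q < B.ncard ∧ B.ncard ≤ d} with hS₂
  have hsplit : S ⊆ S₁ ∪ S₂ := by
    intro B hB
    have hBfin : B.Finite := M.ground_finite.subset hB.1
    have hle : q ≤ B.ncard := by
      have := M.eRk_le_encard B
      rw [hB.2.1, ← hBfin.cast_ncard_eq] at this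
      exact_mod_cast this
    rcases hle.lt_or_eq with h | h
    · exact Or.inr ⟨hB.1, hB.2.1, h, hB.2.2⟩
    · exact Or.inl ⟨by rw [hE]; exact hB.1, h.symm⟩
  have hS₁fin : S₁.Finite := (Ef.finite_toSet.finite_subsets).subset (fun B hB => hB.1)
  have hS₂fin : S₂.Finite := M.ground_finite.finite_subsets.subset (fun B hB => hB.1)
  have hS₁ : S₁.ncard = M.E.ncard.choose q := by
    rw [hS₁, ncard_subsets_ncard_eq Ef q, hEcard]
  set Ps := (pairsSmall M q f').card with hPs
  have hPb : (pairsBig M q f').card = 0 := by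
    rw [pairsBig_eq_empty q f' hd hsmall]; rfl
  have hlevel : ∀ m ∈ Finset.Icc (q + 1) d, ((levelF M q m).card : ℚ) ≤
      ((Ps : ℚ) * ((f' - q).choose (m - (q + 1)) : ℚ)) / ((m - q : ℕ) : ℚ) := by
    intro m hm
    rw [Finset.mem_Icc] at hm
    have hpos : (0 : ℚ) < ((m - q : ℕ) : ℚ) := by exact_mod_cast (by omega : 0 < m - q)
    rw [le_div_iff₀ hpos]
    have h := mul_card_levelF_le q f f' hcirc hflat m
    rw [hPb, zero_mul, add_zero] at h
    have h' : (((m - q) * (levelF M q m).card : ℕ) : ℚ) ≤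
        ((Ps * (f' - q).choose (m - (q + 1)) : ℕ) : ℚ) := by
      exact_mod_cast h
    push_cast at h'
    linarith
  have hS₂q : (S₂.ncard : ℚ) ≤ ∑ m ∈ Finset.Icc (q + 1) d,
      ((Ps : ℚ) * ((f' - q).choose (m - (q + 1)) : ℚ)) / ((m - q : ℕ) : ℚ) := by
    calc (S₂.ncard : ℚ) ≤ ((∑ m ∈ Finset.Icc (q + 1) d, (levelF M q m).card : ℕ) : ℚ) := by
          exact_mod_cast ncard_dep_le_sum_levelF q d
      _ = ∑ m ∈ Finset.Icc (q + 1) d, ((levelF M q m).card : ℚ) := by push_cast; rfl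
      _ ≤ _ := Finset.sum_le_sum hlevel
  have hre : ∑ m ∈ Finset.Icc (q + 1) d,
      ((Ps : ℚ) * ((f' - q).choose (m - (q + 1)) : ℚ)) / ((m - q : ℕ) : ℚ) =
      ∑ j ∈ Finset.range (d - q), ((Ps : ℚ) * ((f' - q).choose j : ℚ)) / ((j : ℚ) + 1) := by
    rw [show Finset.Icc (q + 1) d = Finset.image (fun j => q + 1 + j) (Finset.range (d - q)) from ?_]
    · rw [Finset.sum_image (fun a _ b _ h => by omega)]
      apply Finset.sum_congr rfl
      intro j _
      rw [show q + 1 + j - (q + 1) = j by omega, show q + 1 + j - q = j + 1 by omega]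
      push_cast
      ring
    · ext m
      rw [Finset.mem_Icc, Finset.mem_image]
      constructor
      · intro hm
        exact ⟨m - (q + 1), by rw [Finset.mem_range]; omega, by omega⟩
      · rintro ⟨j, hj, rfl⟩
        rw [Finset.mem_range] at hj
        omega
  have hrange : Finset.range (d - q) ⊆ Finset.range (d - (q + 1) + 1) := Finset.range_mono (by omega)
  have hS₂q' : (S₂.ncard : ℚ) ≤
      (Ps : ℚ) * ∑ j ∈ Finset.range (d - (q + 1) + 1), ((f' - q).choose j : ℚ) / (j + 1) := by
    rw [Finset.mul_sum]
    refine hS₂q.trans (hre.le.trans ?_)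
    refine Finset.sum_le_sum_of_subset_of_nonneg hrange (fun j _ _ => by positivity) |>.trans' ?_
    apply le_of_eq
    apply Finset.sum_congr rfl
    intro j _
    field_simp
  have hPsq : (Ps : ℚ) ≤ ∑ k ∈ Finset.Icc 3 (q + 1),
      ({C | M.IsCircuit C ∧ C.ncard = k}.ncard : ℚ) * (M.E.ncard.choose (q + 1 - k) : ℚ) := by
    have h1 : Ps ≤ (pairsF M q).card := Finset.card_filter_le _ _
    have h2 := card_pairsF_le (M := M) q
    have : ((Ps : ℕ) : ℚ) ≤ ((∑ k ∈ Finset.Icc 3 (q + 1),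
        {C | M.IsCircuit C ∧ C.ncard = k}.ncard * M.E.ncard.choose (q + 1 - k) : ℕ) : ℚ) := by
      exact_mod_cast h1.trans h2
    push_cast at this
    exact this
  have hσs0 : (0 : ℚ) ≤ ∑ j ∈ Finset.range (d - (q + 1) + 1), ((f' - q).choose j : ℚ) / (j + 1) :=
    Finset.sum_nonneg (fun j _ => by positivity)
  have hSq : (S.ncard : ℚ) ≤ (S₁.ncard : ℚ) + (S₂.ncard : ℚ) := by
    have : S.ncard ≤ S₁.ncard + S₂.ncard :=
      (ncard_le_ncard hsplit (hS₁fin.union hS₂fin)).trans (ncard_union_le _ _)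
    exact_mod_cast this
  rw [hS₁] at hSq
  have e1 := mul_le_mul_of_nonneg_right hPsq hσs0
  calc (S.ncard : ℚ) ≤ (M.E.ncard.choose q : ℚ) + (S₂.ncard : ℚ) := hSq
    _ ≤ _ := by linarith [hS₂q', e1]

end Matroid

end PercRepro
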